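import Summits.BirchSwinnertonDyer.Rank1Residual.X12.O11.RamifiedRelativeRubinFormulaLineZp
import HarnessLib

set_option linter.dupNamespace false
set_option autoImplicit false

/-!
# K7r value crux `EllipticUnitValueSevenOfGZK` (stmt-BirchSwinnertonDyer-19945), line `rubin-formula-zp`:
# LAW RRF ⟹ STABILITY of the valuation sequence (hypothesis H-STAB of the S_arch census) with the stable
# value read off Rubin's expressions (cell `bsd-cm`, line owner `bsd-cm-k7r-c4` g8; `--supports` 19945;
# sorry-free kernel glue between two typed conjectures; nothing asserted)

HONEST FRAMING. `X12/O11/RamifiedRelativeRubinFormulaLineZp.lean` (p497249) types the cell's value law of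
record, LAW RRF (`RamifiedCMRelativeRubinFormulaAtZp`): the rational squares `r_m = (L_W(p^m)/L_{W₀}(p^m))²`
CONVERGE `p`-adically to `L := (|D|/|D₀|)·(Rub(W)/Rub(W₀))²`. `X12/O11/RamifiedArchimedeanLawLineZp.lean`
(p493282) types the valuation law `S_law` (`ord_p r_m = B(W)` above the threshold); the pre-registered ENGINE-C
census tests H-STAB («the valuation is eventually stable») and H-BSD («the stable value is `B`»). THIS FILE is
the elementary `p`-adic link: §1 a general lemma — a sequence of rationals converging in `ℚ_p` to a NON-ZERO
limit has EVENTUALLY CONSTANT `p`-adic valuation, equal to the valuation of the limit (ultrametric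
inequality); §2 hence LAW RRF ⟹ H-STAB for every instance of its telescope with `L ≠ 0`, the stable value
being `Padic.valuation L = 2·(ord_p Rub(W) − ord_p Rub(W₀))` (+ `ord_p(|D|/|D₀|) = 0` on 𝒞₇) — so a KILL of
H-STAB at a member kills RRF there, and H-BSD becomes the separate bookkeeping identity
`2·ord₇ Rub(W_D) = B(D)` of the cell memo RRF-ram-g10 §1 (R0)–(R1). CONDITIONAL on RRF (a conjecture);
nothing closed; BSD is not proved by any of this.

References: cell texts PREREG-RRF-ram-g10.md, RRF-ram-g10.md v3 §1 (R0)–(R1), STATUS D128 (c2)/D132; F. Gouvêa,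
*p-adic Numbers* (1993) §3.3 (ultrametric «isosceles» property) [Gouvea1993PadicNumbers].
-/

noncomputable section

open scoped Classical Topology

open Filter

namespace Summit.BirchSwinnertonDyer.BirchSwinnertonDyer.Theorems.RamifiedSevenEllipticUnits

namespace RelativeRubinFormulaStability

/-! ## §1 Rationals converging `p`-adically to a non-zero limit have eventually constant valuation -/

section General

variable {p : ℕ} [hp : Fact p.Prime]

/-- **Isosceles**: in `ℚ_p`, `‖x − L‖ < ‖L‖ ⟹ ‖x‖ = ‖L‖`. [cite: Gouvea1993PadicNumbers, §3.3 (the strong triangle inequality; shape only)] -/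
theorem norm_eq_of_norm_sub_lt {x L : ℚ_[p]} (h : ‖x - L‖ < ‖L‖) : ‖x‖ = ‖L‖ := by
  have hne : ‖L‖ ≠ ‖x - L‖ := ne_of_gt h
  have hmax := IsUltrametricDist.norm_add_eq_max_of_norm_ne_norm hne
  rw [add_sub_cancel] at hmax
  rw [hmax, max_eq_left h.le]

/-- For a non-zero rational `q`, `‖(q : ℚ_p)‖ = p^(−padicValRat p q)`. [folklore] -/
theorem norm_ratCast_eq_zpow {q : ℚ} (hq : q ≠ 0) :
    ‖((q : ℚ) : ℚ_[p])‖ = (p : ℝ) ^ (-padicValRat p q) := by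
  rw [Padic.eq_padicNorm, padicNorm.eq_zpow_of_nonzero hq]
  push_cast
  rfl

/-- **A sequence of rationals converging `p`-adically to a NON-ZERO limit `L` is eventually non-zero with
`p`-adic valuation equal to `Padic.valuation L`** (hence eventually constant — STABILITY).
[cite: Gouvea1993PadicNumbers, §3.3 (shape only)] -/
theorem eventually_padicValRat_eq_of_tendsto {r : ℕ → ℚ} {L : ℚ_[p]} (hL : L ≠ 0)
    (h : Tendsto (fun m : ℕ => ((r m : ℚ) : ℚ_[p])) atTop (𝓝 L)) :
    ∀ᶠ m in atTop, r m ≠ 0 ∧ padicValRat p (r m) = L.valuation := by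
  have hp1 : (1 : ℝ) < (p : ℝ) := by exact_mod_cast hp.out.one_lt
  have hLpos : 0 < ‖L‖ := norm_pos_iff.2 hL
  have hev : ∀ᶠ m in atTop, ‖((r m : ℚ) : ℚ_[p]) - L‖ < ‖L‖ :=
    (tendsto_iff_norm_sub_tendsto_zero.1 h).eventually (gt_mem_nhds hLpos)
  filter_upwards [hev] with m hm
  have hnorm : ‖((r m : ℚ) : ℚ_[p])‖ = ‖L‖ := norm_eq_of_norm_sub_lt hm
  have hr0 : r m ≠ 0 := by
    intro h0
    rw [h0, Rat.cast_zero, norm_zero] at hnorm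
    exact hLpos.ne hnorm
  refine ⟨hr0, ?_⟩
  rw [norm_ratCast_eq_zpow hr0, Padic.norm_eq_zpow_neg_valuation hL] at hnorm
  have hinj := zpow_right_injective₀ (by positivity : (0 : ℝ) < p) hp1.ne' hnorm
  simpa using hinj

end General

/-! ## §2 LAW RRF ⟹ H-STAB with the stable value read off Rubin's expressions -/

section RRF

open WeierstrassCurve NumberField IsDedekindDomain Field
  Literature.NumberTheory.EllipticCurves
  Literature.NumberTheory.EllipticCurves.Rank1Residual
  Literature.NumberTheory.GaloisRepresentations
  Literature.NumberTheory.DiophantineGeometry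
  Summit.BirchSwinnertonDyer.Rank1Residual Summit.BirchSwinnertonDyer.Rank1Residual.X12
  Summit.BirchSwinnertonDyer.Rank1Residual.X12.O11

variable {W : WeierstrassCurve ℚ} [W.IsElliptic] [W.IsGloballyMinimal] {p : ℕ} [Fact p.Prime] {D₀ : ℤ}

omit [W.IsGloballyMinimal] in
/-- **LAW RRF ⟹ STABILITY (H-STAB) with the stable valuation `= Padic.valuation L`.** Under
`RamifiedCMRelativeRubinFormulaAtZp W p D₀`, at every instance of its telescope whose limit
`L = (|D|/|D₀|)·(Rub(W)/Rub(W₀))²` is NON-ZERO (in the cell's census: `Rub(W₀) ≠ 0` for the unit base, `Rub(W) ≠ 0`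
in analytic rank one), the squared central-value ratios `r_m` are eventually non-zero with CONSTANT `p`-adic
valuation `Padic.valuation L` — the census hypothesis H-STAB, with the stable value identified; H-BSD is then
the separate identity `Padic.valuation L = B(W)` ((R0)–(R1) bookkeeping of the cell memo). CONDITIONAL on RRF.
[cite: Gouvea1993PadicNumbers, §3.3 (shape only)] [cite: Rubin1992, Thm. 1 (shape of Rub; split p)] -/
theorem eventually_padicValRat_eq_of_relativeRubinFormula (hRRF : RamifiedCMRelativeRubinFormulaAtZp W p D₀)
    {K : Type} [Field K] [NumberField K] {𝔭 : HeightOneSpectrum (𝓞 K)}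
    {W' : WeierstrassCurve ℚ} [W'.IsElliptic] [W'.IsGloballyMinimal] {C : VariableChange ℚ}
    (hF : IsFrame W p K 𝔭 W' C) (hr1 : W.analyticRank = 1)
    {D : ℤ} (hD : ∃ C₁ : VariableChange ℚ, C₁ • W = cm7.quadraticTwist (D : ℚ))
    {P : W.toAffine.Point} {qL : ℚ} (hP : ¬ IsOfFinAddOrder P)
    (hgen : ∀ R : W.toAffine.Point, ∃ (k : ℤ) (T : W.toAffine.Point), IsOfFinAddOrder T ∧ R = k • P + T)
    (hqL : W.leadingLCoeff / ((W.realPeriodRat : ℂ) * (W.regulator : ℂ)) = (qL : ℂ))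
    {φ : HeckeCharacter K} (hφ : ∀ s : ℂ, 3 / 2 < s.re → heckeLFunction φ s = W.LSeries s)
    {W₀ : WeierstrassCurve ℚ} [W₀.IsElliptic] [W₀.IsGloballyMinimal]
    (hW₀ : ∃ C₀ : VariableChange ℚ, C₀ • W₀ = cm7.quadraticTwist (D₀ : ℚ))
    {P₀ : W₀.toAffine.Point} {qL₀ : ℚ} (hP₀ : ¬ IsOfFinAddOrder P₀)
    (hgen₀ : ∀ R : W₀.toAffine.Point, ∃ (k : ℤ) (T : W₀.toAffine.Point), IsOfFinAddOrder T ∧ R = k • P₀ + T)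
    (hqL₀ : W₀.leadingLCoeff / ((W₀.realPeriodRat : ℂ) * (W₀.regulator : ℂ)) = (qL₀ : ℂ))
    {φ₀ : HeckeCharacter K} (hφ₀ : ∀ s : ℂ, 3 / 2 < s.re → heckeLFunction φ₀ s = W₀.LSeries s)
    {c : ℕ} (hc : c ≠ 0)
    (hcP : (W.baseChange ℚ_[p]).IsInReductionKernel (c • W.toPadicPoint p P))
    (hcP₀ : (W₀.baseChange ℚ_[p]).IsInReductionKernel (c • W₀.toPadicPoint p P₀))
    {r : ℕ → ℚ}
    (hr : ∀ m : ℕ, (heckePowerCentralValue φ (p ^ m) / heckePowerCentralValue φ₀ (p ^ m)) ^ 2 = (r m : ℂ))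
    (hL : (((D.natAbs : ℕ) : ℚ_[p]) / ((D₀.natAbs : ℕ) : ℚ_[p])) *
      (padicRubinValue W p P qL c / padicRubinValue W₀ p P₀ qL₀ c) ^ 2 ≠ 0) :
    ∀ᶠ m in atTop, r m ≠ 0 ∧ padicValRat p (r m) =
      ((((D.natAbs : ℕ) : ℚ_[p]) / ((D₀.natAbs : ℕ) : ℚ_[p])) *
        (padicRubinValue W p P qL c / padicRubinValue W₀ p P₀ qL₀ c) ^ 2).valuation :=
  eventually_padicValRat_eq_of_tendsto hL
    (hRRF K 𝔭 W' C hF hr1 D hD P qL hP hgen hqL φ hφ W₀ hW₀ P₀ qL₀ hP₀ hgen₀ hqL₀ φ₀ hφ₀ c hc hcP hcP₀ r hr)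

end RRF

end RelativeRubinFormulaStability

end Summit.BirchSwinnertonDyer.BirchSwinnertonDyer.Theorems.RamifiedSevenEllipticUnits

end
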